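import Literature.MathematicalPhysics.QuantumLattice.SourcedHubbardBlockCut
import Literature.MathematicalPhysics.QuantumLattice.InfVolFermionState
import Literature.MathematicalPhysics.QuantumLattice.HubbardCommutatorBound

/-!
# Route `CooperPairDMottWalk`, crux `CooperPairDMott` (stmt-HubbardSuperconductivity-1177):
# locality of second-quantised block operators

Support file for the stub `stub_pairTrialCeiling`. For an order embedding of orbital sets
`e : ι ↪o ι'`, the second quantisation `jwEmbed e` (the tree's `FermionEmbedding`) maps the whole
matrix algebra of the small Fock space INTO the CAR subalgebra of its range
(`jwEmbed_mem_carSubalgebra`; the Jordan–Wigner operators generate everything,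
`carSubalgebra_univ_eq_top`), and even elements into even elements
(`jwEmbed_mem_carEvenSubalgebra`). Consequences used by the trial-state argument of the pair
ceiling: graded commutativity of an arbitrary embedded block operator with every even operator
localised away from the block (`commute_jwEmbed_of_mem_carEvenSubalgebra`,
`commute_jwEmbed_jwEmbed`), evenness of (embedded) Hubbard Hamiltonians
(`hamiltonian_mem_carEvenSubalgebra`, `jwEmbed_hamiltonian_mem_carEvenSubalgebra`), positivity
transport (`posSemidef_jwEmbed`), and the bookkeeping identities between the three orbital-set
constructors of the tree (`rangeF (orbEmb e) = orbs (e Λ) = orbSet (e Λ)`).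

References: O. Bratteli, D. W. Robinson, *Operator Algebras and Quantum Statistical Mechanics II*
(1997), §5.2.2 (isotony and graded locality of the local CAR algebras; Thm. 5.2.5). All statements
are [folklore]; no definition is introduced.
-/

set_option linter.dupNamespace false

noncomputable section

namespace Summit.HubbardSuperconductivity.HubbardSuperconductivity.Theorems.CooperPairDMottWalk

open Matrix Finset Literature.MathematicalPhysics.QuantumLattice
open Literature.MathematicalPhysics.QuantumLattice.JWEmbed
open scoped ComplexOrder MatrixOrder

/-! ### Orbital sets: second quantisation lands in the CAR subalgebra of the range -/

section CAR

variable {ι ι' : Type*} [LinearOrder ι] [Fintype ι] [LinearOrder ι'] [Fintype ι'] (e : ι ↪o ι')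

/-- `jwEmbed` sends the generator `c_i^{(†)}` to the generator `c_{e i}^{(†)}`. [folklore] -/
theorem jwEmbed_letterOp (l : JWLetter ι) : jwEmbed e (letterOp l) = letterOp (e l.1, l.2) := by
  obtain ⟨i, b⟩ := l
  cases b
  · simp only [letterOp, Bool.false_eq_true, if_false, jwEmbed_annihilation]
  · simp only [letterOp, if_true, jwEmbed_creation]

/-- **Second quantisation lands in the CAR algebra of the range**: `jwEmbed e a ∈ 𝔄(e ι)` for EVERY
matrix `a` of the small Fock space (the `c_i, c†_i` generate the full matrix algebra, and `jwEmbed e`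
maps generators to generators of the range). [cite: BratteliRobinsonII1997, §5.2.2, Thm. 5.2.5] -/
theorem jwEmbed_mem_carSubalgebra (a : Matrix (Finset ι) (Finset ι) ℂ) :
    jwEmbed e a ∈ carSubalgebra (rangeF e) := by
  have ha : a ∈ carSubalgebra (Finset.univ : Finset ι) := by
    rw [carSubalgebra_univ_eq_top]; exact Algebra.mem_top
  have hmap : (carSubalgebra (Finset.univ : Finset ι)).map (jwEmbed e) ≤ carSubalgebra (rangeF e) := by
    rw [carSubalgebra, AlgHom.map_adjoin]
    refine Algebra.adjoin_mono ?_
    rintro _ ⟨M, ⟨l, -, rfl⟩, rfl⟩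
    exact ⟨(e l.1, l.2), apply_mem_rangeF l.1, (jwEmbed_letterOp e l).symm⟩
  exact hmap (Subalgebra.mem_map.2 ⟨a, ha, rfl⟩)

/-- **Even goes to even**: `jwEmbed e` maps the even CAR subalgebra of `S` into the even CAR
subalgebra of `e S`. [cite: BratteliRobinsonII1997, §5.2.2 (even subalgebra)] -/
theorem jwEmbed_mem_carEvenSubalgebra {S : Finset ι} {a : Matrix (Finset ι) (Finset ι) ℂ}
    (ha : a ∈ carEvenSubalgebra S) : jwEmbed e a ∈ carEvenSubalgebra (S.map e.toEmbedding) := by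
  have hmap : (carEvenSubalgebra S).map (jwEmbed e) ≤ carEvenSubalgebra (S.map e.toEmbedding) := by
    rw [carEvenSubalgebra, AlgHom.map_adjoin]
    refine Algebra.adjoin_mono ?_
    rintro _ ⟨M, ⟨l, l', hl, hl', rfl⟩, rfl⟩
    refine ⟨(e l.1, l.2), (e l'.1, l'.2), Finset.mem_map_of_mem e.toEmbedding hl,
      Finset.mem_map_of_mem e.toEmbedding hl', ?_⟩
    rw [map_mul, jwEmbed_letterOp, jwEmbed_letterOp]
  exact hmap (Subalgebra.mem_map.2 ⟨a, ha, rfl⟩)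

omit [Fintype ι'] in
/-- The range finset of an order embedding is the image of `univ` (definitional). [folklore] -/
theorem rangeF_eq_map_univ : rangeF e = (Finset.univ : Finset ι).map e.toEmbedding := rfl

/-- **Graded locality of an embedded block operator**: `jwEmbed e a` commutes with every even operator
localised in a set of orbitals disjoint from the range of `e`. [cite: BratteliRobinsonII1997, §5.2.2] -/
theorem commute_jwEmbed_of_mem_carEvenSubalgebra (a : Matrix (Finset ι) (Finset ι) ℂ)
    {S : Finset ι'} {b : Matrix (Finset ι') (Finset ι') ℂ} (hb : b ∈ carEvenSubalgebra S)
    (hS : Disjoint S (rangeF e)) : Commute (jwEmbed e a) b :=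
  (commute_of_mem_carEvenSubalgebra hb (jwEmbed_mem_carSubalgebra e a) hS).symm

/-- **Positivity transport**: `jwEmbed e` (a `*`-homomorphism) maps positive semidefinite matrices to
positive semidefinite matrices (`x = yᴴ y ↦ (e_* y)ᴴ (e_* y)`). [folklore] -/
theorem posSemidef_jwEmbed {x : Matrix (Finset ι) (Finset ι) ℂ} (hx : x.PosSemidef) :
    (jwEmbed e x).PosSemidef := by
  obtain ⟨y, hy⟩ := CStarAlgebra.nonneg_iff_eq_star_mul_self.mp hx.nonneg
  rw [hy, map_mul, star_eq_conjTranspose, jwEmbed_conjTranspose]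
  exact posSemidef_conjTranspose_mul_self _

end CAR

/-! ### Site sets: blocks of a Hubbard system -/

section Sites

variable {Λ Λ' : Type*} [LinearOrder Λ] [Fintype Λ] [LinearOrder Λ'] [Fintype Λ']

/-- The tree's two orbital-set constructors agree: `orbSet X = orbs X`. [folklore] -/
theorem orbSet_eq_orbs (X : Finset Λ) : orbSet X = orbs X := by
  ext i
  rw [mem_orbSet, mem_orbs]

omit [LinearOrder Λ'] [Fintype Λ'] in
/-- An orbital is the orbital of its site and spin. [folklore] -/
theorem orb_ofLex_eq (i : Orb Λ') : orb (ofLex i).1 (ofLex i).2 = i := rfl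

omit [Fintype Λ'] in
/-- The range of the orbital embedding of `e : Λ ↪o Λ'` is the orbital set of the image sites.
[folklore] -/
theorem rangeF_orbEmb (e : Λ ↪o Λ') :
    rangeF (orbEmb e) = orbs ((Finset.univ : Finset Λ).map e.toEmbedding) := by
  ext i
  rw [mem_rangeF, mem_orbs]
  constructor
  · rintro ⟨j, rfl⟩
    rw [← orb_ofLex_eq j, orbEmb_orb]
    exact Finset.mem_map_of_mem e.toEmbedding (Finset.mem_univ _)
  · intro hi
    obtain ⟨x, -, hx⟩ := Finset.mem_map.1 hi
    refine ⟨orb x (ofLex i).2, ?_⟩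
    rw [orbEmb_orb, show e x = (ofLex i).1 from hx, orb_ofLex_eq]

/-- **The Hubbard Hamiltonian is even**: `H_G(t, U)` lies in the even CAR subalgebra of all orbitals
(it is a polynomial in `c†c` and `n n`). [cite: BratteliRobinsonII1997, §5.2.2 (even subalgebra)] -/
theorem hamiltonian_mem_carEvenSubalgebra (G : SimpleGraph Λ) [DecidableRel G.Adj] (t U : ℝ) :
    hamiltonian G t U ∈ carEvenSubalgebra (orbs (Finset.univ : Finset Λ)) := by
  rw [← hamiltonianWith_zero, hamiltonianWith_eq_onSiteSum_sub_hopSum]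
  exact Subalgebra.sub_mem _ (onSiteSum_mem _ _ subset_rfl)
    (hopSum_mem fun b _ => ⟨Finset.mem_univ _, Finset.mem_univ _⟩)

/-- **An embedded block Hamiltonian is an even operator of the block**:
`(e)_* H_{G}(t, U) ∈ 𝔄⁺(orbs (e Λ))`. [cite: BratteliRobinsonII1997, §5.2.2] -/
theorem jwEmbed_hamiltonian_mem_carEvenSubalgebra (e : Λ ↪o Λ') (G : SimpleGraph Λ) [DecidableRel G.Adj]
    (t U : ℝ) :
    jwEmbed (orbEmb e) (hamiltonian G t U) ∈
      carEvenSubalgebra (orbs ((Finset.univ : Finset Λ).map e.toEmbedding)) := by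
  have h := jwEmbed_mem_carEvenSubalgebra (orbEmb e) (hamiltonian_mem_carEvenSubalgebra G t U)
  rwa [orbs_univ, ← rangeF_eq_map_univ, rangeF_orbEmb] at h

/-- Any even operator of the small system embeds to an even operator of the block. [folklore] -/
theorem jwEmbed_mem_carEvenSubalgebra_orbs (e : Λ ↪o Λ') {a : Matrix (Finset (Orb Λ)) (Finset (Orb Λ)) ℂ}
    (ha : a ∈ carEvenSubalgebra (Finset.univ : Finset (Orb Λ))) :
    jwEmbed (orbEmb e) a ∈ carEvenSubalgebra (orbs ((Finset.univ : Finset Λ).map e.toEmbedding)) := by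
  have h := jwEmbed_mem_carEvenSubalgebra (orbEmb e) ha
  rwa [← rangeF_eq_map_univ, rangeF_orbEmb] at h

/-- Any operator of the small system embeds into the CAR algebra of the block. [folklore] -/
theorem jwEmbed_mem_carSubalgebra_orbs (e : Λ ↪o Λ') (a : Matrix (Finset (Orb Λ)) (Finset (Orb Λ)) ℂ) :
    jwEmbed (orbEmb e) a ∈ carSubalgebra (orbs ((Finset.univ : Finset Λ).map e.toEmbedding)) := by
  rw [← rangeF_orbEmb]
  exact jwEmbed_mem_carSubalgebra (orbEmb e) a

/-- **Block operators of disjoint blocks commute when one of them is even**. [cite: BratteliRobinsonII1997, §5.2.2] -/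
theorem commute_jwEmbed_jwEmbed {e₁ e₂ : Λ ↪o Λ'}
    (h : Disjoint ((Finset.univ : Finset Λ).map e₁.toEmbedding) ((Finset.univ : Finset Λ).map e₂.toEmbedding))
    {a : Matrix (Finset (Orb Λ)) (Finset (Orb Λ)) ℂ} (ha : a ∈ carEvenSubalgebra (Finset.univ : Finset (Orb Λ)))
    (b : Matrix (Finset (Orb Λ)) (Finset (Orb Λ)) ℂ) :
    Commute (jwEmbed (orbEmb e₁) a) (jwEmbed (orbEmb e₂) b) :=
  commute_of_mem_carEvenSubalgebra (jwEmbed_mem_carEvenSubalgebra_orbs e₁ ha)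
    (jwEmbed_mem_carSubalgebra_orbs e₂ b) (disjoint_orbs h)

/-- **Embedded Hubbard Hamiltonians of disjoint blocks commute with every operator of another block.**
[cite: BratteliRobinsonII1997, §5.2.2] -/
theorem commute_jwEmbed_hamiltonian_jwEmbed {e₁ e₂ : Λ ↪o Λ'}
    (h : Disjoint ((Finset.univ : Finset Λ).map e₁.toEmbedding) ((Finset.univ : Finset Λ).map e₂.toEmbedding))
    (G : SimpleGraph Λ) [DecidableRel G.Adj] (t U : ℝ) (b : Matrix (Finset (Orb Λ)) (Finset (Orb Λ)) ℂ) :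
    Commute (jwEmbed (orbEmb e₁) (hamiltonian G t U)) (jwEmbed (orbEmb e₂) b) := by
  have ha := hamiltonian_mem_carEvenSubalgebra G t U
  rw [orbs_univ] at ha
  exact commute_jwEmbed_jwEmbed h ha b

/-- **Volume-independent commutator bound for a block operator**: on a graph of maximal degree `≤ Δ`,
for any operator `b` of the small system embedded as a block of `k` sites,
`‖[H_G(t,U) − μN, e_* b]‖ ≤ k (2Δ+1) · 2(2|t| + |U| + 2|μ|) ‖e_* b‖` (the tree's
`norm_commutator_hamiltonianWith_le`). [folklore] -/
theorem norm_commutator_hamiltonianWith_jwEmbed_le (G : SimpleGraph Λ') [DecidableRel G.Adj] {Δ : ℕ}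
    (hΔ : ∀ x : Λ', (Finset.univ.filter fun y => G.Adj x y).card ≤ Δ) (t U μ : ℝ) (e : Λ ↪o Λ')
    (b : Matrix (Finset (Orb Λ)) (Finset (Orb Λ)) ℂ) :
    open scoped Matrix.Norms.L2Operator in
    ‖hamiltonianWith G t U μ * jwEmbed (orbEmb e) b - jwEmbed (orbEmb e) b * hamiltonianWith G t U μ‖ ≤
      ((Fintype.card Λ) * (2 * Δ + 1) : ℕ) * (2 * (2 * |t| + |U| + 2 * |μ|) * ‖jwEmbed (orbEmb e) b‖) := by
  have hA : jwEmbed (orbEmb e) b ∈ carSubalgebra (orbSet ((Finset.univ : Finset Λ).map e.toEmbedding)) := by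
    rw [orbSet_eq_orbs]
    exact jwEmbed_mem_carSubalgebra_orbs e b
  have h := norm_commutator_hamiltonianWith_le G hΔ t U μ hA
  rwa [Finset.card_map, Finset.card_univ] at h

end Sites

/-! ### Registered form -/

/-- **Registered sub-goal `pairTrialCeiling_blockLocality`** (graded locality of the plaquette
decomposition in closed form, as registered on the crux item): an embedded Hubbard Hamiltonian of one
block commutes with every operator of a disjoint block. [cite: BratteliRobinsonII1997, §5.2.2] -/
theorem pairTrialCeiling_blockLocality : ∀ {Λ Λ' : Type} [LinearOrder Λ] [Fintype Λ] [LinearOrder Λ'] [Fintype Λ'] {e₁ e₂ : Λ ↪o Λ'}, Disjoint ((Finset.univ : Finset Λ).map e₁.toEmbedding) ((Finset.univ : Finset Λ).map e₂.toEmbedding) → ∀ (G : SimpleGraph Λ) [DecidableRel G.Adj] (t U : ℝ) (b : Matrix (Finset (Orb Λ)) (Finset (Orb Λ)) ℂ), Commute (jwEmbed (orbEmb e₁) (hamiltonian G t U)) (jwEmbed (orbEmb e₂) b) :=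
  fun h G _ t U b => commute_jwEmbed_hamiltonian_jwEmbed h G t U b

end Summit.HubbardSuperconductivity.HubbardSuperconductivity.Theorems.CooperPairDMottWalk

end
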